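import Literature.NumberTheory.EllipticCurves.Rank1Residual.Predicates
import Literature.NumberTheory.EllipticCurves.Isogeny
import Literature.NumberTheory.EllipticCurves.CuspFormLFunction
import Literature.NumberTheory.EllipticCurves.BSDInvariants
import HarnessLib

/-!
# Greenberg–Vatsal, *On the Iwasawa invariants of elliptic curves* (Invent. Math. 142 (2000)),
# §3 Cor. (3.8), period clause: under the parity hypothesis the real period `Ω⁺_E` is the same, up
# to a `p`-adic unit, for all curves of the isogeny class satisfying it

HONEST FRAMING (BSD rank-`≤ 1` residual cell `b2b-bsdres`, home
`run/shared/lean/b2b/bsd-rank1-residual/`, unit `b2b-bsdres-eisenstein-p2`, class X2 = odd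
multiplicative Eisenstein primes): the cell deletes the COMBINATION-SHAPED residual classes of the
rank-`≤ 1` BSD formula from PUBLISHED theorems only and TYPES the construction-shaped ones; this is
not "finishing BSD". This file records ONE published NUMBERED statement as a named fact
(`def … : Prop`, nothing asserted; D-0014/D-0026): the period clause of Greenberg–Vatsal's
Corollary (3.8), in the relative form obtained by applying it to two curves `E`, `E'` of one
`ℚ`-isogeny class (the printed statement compares each with the `X₁(N)`-optimal curve `E_opt` of the
class, for which the tree has no predicate). It is the period input of GV's reduction of the parity
case "`φ` unramified at `p` and odd" of their Thm. (1.3) to the case "`φ` ramified at `p` and even"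
by the `p`-isogeny `E → E/Φ` (p. 28): along that isogeny `λ` does not change (kernel theorem of the
cell, `Summits/…/X2/IsogenyLambdaInvariant.lean`), `μ^alg = 0` on both sides (Greenberg 1999
Prop. 5.10, tree fact `Greenberg1999.prop510_isTorsion_hasUnitContent_of_gvPar`), and the
Néron-normalised `p`-adic `L`-functions `L(E/ℚ,T) = L_f/Ω⁺_E`, `L(E'/ℚ,T) = L_f/Ω⁺_{E'}` differ by
the constant `Ω⁺_{E'}/Ω⁺_E`, a `p`-adic unit by this statement (consumer:
`Summits/…/X2/GreenbergVatsalCaseTwo.lean`).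

## Citation header (read by this seat on the held text arXiv:math/9906215 =
## `paper:arxiv-math_9906215`, decoded `HOME/…/work/lit/gv2000_decoded.txt`; file p0055 = p. 32,
## p0059 = p. 36, p0061 = p. 38, p0063 = p. 40, p0065 = p. 42; journal pagination Invent. Math. 142)

* §3, p. 32 (standing hypotheses): "Let `E` be a modular elliptic curve of conductor `N`, and let
  `p` be a fixed odd prime. We assume that `E` has either good ordinary or multiplicative reduction
  at `p`, corresponding to the two cases `(N, p) = 1` and `(p, N/p) = 1` respectively."
* p. 36: "Given a `ℚ`-isogeny class `𝒜` of elliptic curves, we call `E ∈ 𝒜` optimal if there exists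
  a modular parametrization `π : X₁(N)_ℚ → E` such that the following equivalent conditions … Thus
  the optimal curve `E` is an analogue for `X₁(N)`-parametrizations of the strong Weil curve arising
  from parametrizations by `X₀(N)`. … The optimal curves were introduced and studied by Stevens
  [Ste89]."
* **Corollary (3.8)**, p. 40: "Assume that `E` admits a cyclic `p`-isogeny with kernel `Φ`, such
  that `Φ` is either unramified at `p` and odd, or ramified at `p` and even, as a Galois module.
  Then the `χ`-twisted `p`-adic `L`-function of `E` is represented by an integral power series, for
  any even character `χ`. If `E_opt` is the optimal curve in the isogeny class of `E`, then the
  period `Ω⁺_E` coincides with `Ω⁺_{E_opt}`, up to `p`-adic unit." Proof: "It suffices to verify the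
  final assertion. But this follows by exactly the same argument as was used in the conclusion of
  the proof of Lemma (3.6). Namely, one shows that the periods in question coincide with that of the
  minimal curve in the isogeny class."
* proof of Lemma (3.6), p. 38: "we let `E_min` denote the minimal curve in the isogeny class `𝒜` of
  `E` and `B` constructed by Stevens in [Ste89], section 2. Stevens has shown that, if `A ∈ 𝒜`, there
  exists an étale isogeny `φ : E_min → A`. If `±` is an admissible sign, it follows from the
  definitions that the kernel of `φ` has parity `−(±)` for the action of complex conjugation. This
  implies that the periods `Ω^±_A` and `Ω^±_{E_min}` coincide."
* p. 42: "We assume that `ψ` is odd and unramified at `p`, or equivalently that `φ` is even and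
  ramified at `p`. In this case, the admissible sign is plus, and the canonical period is the real
  period of `E` (up to multiplication by a `p`-adic unit)."

## The tree's vocabulary (no new definition)

`E/ℚ` elliptic on a globally minimal model `W` (so that `W.realPeriodRat = ∫_{E(ℝ)}|ω|` is the
Néron real period `Ω⁺_E`; conventions for `Ω⁺` differ by the number of real components, a factor
`2^{0,±1}` in the ratio of two curves, immaterial "up to `p`-adic unit" for `p` odd), `p` an odd
prime of good ordinary (`HasGoodReductionAtPrime` + `p ∤ a_p`, `frobeniusTrace`) or multiplicative
(`HasMultiplicativeReductionAtPrime`) reduction, modularity as `IsNewformOf W f` (a theorem for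
every `E/ℚ`, tree facts `nonempty_modularParametrizationData` / `existsUnique_isNewformOf`),
`ℚ`-isogeny `IsIsogenous` (prelude `Isogeny`), the parity hypothesis `GVPar` (`Rank1Residual/Predicates`:
some rational `p`-isogeny kernel is (ramified at `p` ∧ even) ∨ (unramified at `p` ∧ odd)), and
"`x` coincides with `y` up to `p`-adic unit" for positive reals in one `ℚˣ`-class as
`∃ u : ℚ, ‖(u : ℚ_[p])‖ = 1 ∧ y = u * x` (as in the sibling facts `realPeriodRat_eq_unit_mul_plusPeriod*`,
`ModularCurvePeriodRatio.lean`, which transcribe the IRREDUCIBLE-`E[p]` companion, GV Remark (3.4)).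

References: [GreenbergVatsal2000] §3 p. 32, p. 36, Lemma (3.6) p. 38, Cor. (3.8) p. 40, p. 42;
[Stevens1989] §2 (the minimal curve and its étale isogenies).
-/

set_option autoImplicit false

noncomputable section

open scoped Classical MatrixGroups ModularForm

open CongruenceSubgroup WeierstrassCurve Literature.NumberTheory.EllipticCurves
  Literature.NumberTheory.EllipticCurves.ModularForms
  Literature.NumberTheory.EllipticCurves.Rank1Residual

namespace Literature.NumberTheory.EllipticCurves.GreenbergVatsal2000

/-- **Greenberg–Vatsal 2000, Cor. (3.8) (period clause), for two curves of one isogeny class.**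
Invent. Math. 142 (2000), §3, Cor. (3.8), p. 40: "Assume that `E` admits a cyclic `p`-isogeny with
kernel `Φ`, such that `Φ` is either unramified at `p` and odd, or ramified at `p` and even, as a
Galois module. Then … If `E_opt` is the optimal curve in the isogeny class of `E`, then the period
`Ω⁺_E` coincides with `Ω⁺_{E_opt}`, up to `p`-adic unit" — under the standing hypotheses of §3
(p. 32: "`E` a modular elliptic curve of conductor `N`, `p` a fixed odd prime, `E` has either good
ordinary or multiplicative reduction at `p`"), `E_opt` the `X₁(N)`-optimal curve of the class (p. 36,
Stevens); proof p. 40 with p. 38 (Stevens' étale isogenies `E_min → A`, whose kernels are odd under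
the parity hypothesis, so that `Ω⁺_A = Ω⁺_{E_min}`). TRANSCRIPTION (relative form): for `E`, `E'`
elliptic curves over `ℚ` on globally minimal models, `ℚ`-ISOGENOUS, `E` modular (newform `f`),
`p` odd of good ordinary or multiplicative reduction for `E`, and BOTH `E` and `E'` satisfying the
parity hypothesis `GVPar` (each admits a rational `p`-isogeny kernel unramified-odd or
ramified-even), the Néron real periods satisfy `Ω⁺_{E'} = u · Ω⁺_E` with `u ∈ ℚ` a `p`-adic unit
(`|u|_p = 1`, the phrasing of the sibling facts `realPeriodRat_eq_unit_mul_plusPeriod*` of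
`ModularCurvePeriodRatio.lean`, which transcribe the IRREDUCIBLE companion Remark (3.4)) — Cor. (3.8)
applied to `E` and to `E'`, which share `E_opt`. Named fact; nothing asserted.
-- TODO(general form): GV state `Ω⁺_E ≐ Ω⁺_{E_opt}` for the `X₁(N)`-OPTIMAL curve `E_opt` of the
-- class (and the integrality of the `χ`-twisted `p`-adic `L`-function of `E` for even `χ`); the tree
-- has no `X₁(N)`-optimality predicate, so only the consequence for two members of the class both
-- satisfying the hypothesis is transcribed.
[cite: GreenbergVatsal2000, §3 Cor. (3.8) (p. 40) with p. 32, p. 36 and the proof of Lemma (3.6) (p. 38)] -/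
def cor38_realPeriodRat_eq_unit_mul_of_isIsogenous_of_gvPar : Prop :=
  ∀ (W W' : WeierstrassCurve ℚ) [W.IsElliptic] [W'.IsElliptic] [W.IsGloballyMinimal]
    [W'.IsGloballyMinimal] (p : ℕ) [Fact p.Prime] {N : ℕ} [NeZero N] {f : CuspForm (Gamma0 N) 2},
    p ≠ 2 → IsNewformOf W f →
    (W.HasGoodReductionAtPrime p ∧ ¬ (p : ℤ) ∣ W.frobeniusTrace p) ∨
      W.HasMultiplicativeReductionAtPrime p →
    IsIsogenous W W' → GVPar W p → GVPar W' p →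
    ∃ u : ℚ, ‖(u : ℚ_[p])‖ = 1 ∧ W'.realPeriodRat = (u : ℝ) * W.realPeriodRat

end Literature.NumberTheory.EllipticCurves.GreenbergVatsal2000

end
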